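import Mathlib
import Literature.Probability.Percolation.MinOpenCut
import Literature.Probability.Percolation.BondPercolationSymmetry
import Literature.Probability.Percolation.LatticeSymmetry
import Literature.Probability.Percolation.SiteConnectionTools
import Summits.CriticalPhenomena.PercolationContinuityZ3.Theorems.PercBudgetLadderPinholeClosingStubSignedSymmetry
import Summits.CriticalPhenomena.PercolationContinuityZ3.Theorems.PinholeClosing.Negative.PinholeClosingBaseline
import HarnessLib

/-!
# Crux `PercBudgetLadder.PinholeClosing` (stmt-CriticalPhenomena-5249) — half-space halving of the budget

Helper file for the crux (lead `prover-line-stmt-CriticalPhenomena-5249-c2-0`, line `balanced-deletion`, registered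
auxiliary stub `stub_halfspaceHalving`; `--supports stmt-CriticalPhenomena-5249`).  No new definitions: every
statement is in the tree's vocabulary (`bondPercolation (zdGraph 3) (criticalProbI 3)`, `box`, `innerBoundary`,
`openConnIn`, raw budget set-builders as in the route file).

**Statement (pinholes polarise; the `k ≥ 1` analogue of `stub_pinholeBehindPlane`).**  Fix an axis `i`.  If the
annulus `box 3 n → ∂ⁱⁿ box 3 L` of `ℤ³` can be blocked inside `box 3 L` by closing a set `S` of at most `k + 1`
edges, then for one of the two signs `σ = ±1` the OPEN half-box `{v ∈ box 3 L | σ v_i ≥ 1}` can be blocked (no open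
path from `box 3 n` to `∂ⁱⁿ box 3 L` confined to it) by closing at most `⌊(k+1)/2⌋` edges — deterministically,
configuration by configuration (`stub_halfspaceHalving`).  Consequently (union bound, `halving_real_le`) the
budget-`(k+1)` blocking probability is at most the sum over `σ = ±1` of the two half-box budget-`⌊(k+1)/2⌋` blocking
probabilities; the two summands are equal by the reflection `v_i ↦ -v_i` (not needed here).

**Proof.**  Split `S` into `S₊ = {e ∈ S | every endpoint has σ v_i ≥ 1}` for `σ = 1` and `S₋` likewise for
`σ = -1`.  The two parts are disjoint (an endpoint cannot have both `v_i ≥ 1` and `-v_i ≥ 1`), so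
`#S₊ + #S₋ ≤ #S ≤ k + 1` and one of them has at most `⌊(k+1)/2⌋` elements.  A path confined to the open half-box
`{σ v_i ≥ 1}` only traverses edges both of whose endpoints lie in it, so if it avoids `S_σ` it avoids `S`
altogether and is an `(ω ∖ S)`-open crossing inside `box 3 L` — contradicting the blocking
(`HalfspaceHalving.front_blocked_of_cut`, a graph homomorphism between induced open graphs, exactly as in
`StubPinholeBehindPlane.front_blocked_of_polar`).

Why it is recorded (lead c2, `Cruxes/PinholeClosing/LEAD-c2-NOTE-1.md`): this is the entire FREE input of every
polarisation attack on the `k ≥ 1` rungs — from budget-`(k+1)` tightness at `(n, ln)` one gets, at no cost and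
uniformly in `n`, half-box blocking with HALF the budget (with probability `≥ c/2` for the canonical half-box after
the reflection symmetry); at `k = 1` this is half-box budget ONE.  The note explains why Harris–FKG tiling of these
half-box events cannot conclude at `k ≥ 1` (two confined crossings in one tile are needed, and wiggling arms evade
confinement), in contrast with `k = 0` where one confined crossing in a boundary tile suffices (`pinholeClosing_zero`).
-/

noncomputable section

namespace Summit.CriticalPhenomena.PercolationContinuityZ3.Theorems

open MeasureTheory
open scoped Classical
open Literature.Probability.Percolation Literature.Probability.LatticeModels
open Summit.CriticalPhenomena.PercolationContinuityZ3.Theorems.PinholeClosing.Negative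

namespace HalfspaceHalving

/-- **A front cut kills front crossings.**  If closing `S` blocks the annulus `box 3 n → ∂ⁱⁿ box 3 L` inside
`box 3 L`, then closing only the edges of `S` both of whose endpoints lie in the open half-space `{σ v_i ≥ 1}`
blocks every crossing confined to the half-box `{v ∈ box 3 L | σ v_i ≥ 1}`: a confined path never traverses an
edge with an endpoint outside the half-space, so it avoids all of `S`. -/
theorem front_blocked_of_cut {n L : ℕ} {ω : BondConfig (Site 3)} {i : Fin 3} {σ : ℤ}
    {S : Finset (Sym2 (Site 3))}
    (hb : ¬ ∃ x ∈ box 3 n, ∃ y ∈ innerBoundary (zdGraph 3) (box 3 L),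
      (ω \ ↑S) ∈ openConnIn ↑(box 3 L) x y) :
    ¬ ∃ x ∈ box 3 n, ∃ y ∈ innerBoundary (zdGraph 3) (box 3 L),
      (ω \ ↑(S.filter fun e => ∀ v ∈ e, 1 ≤ σ * v i)) ∈
        openConnIn {v : Site 3 | v ∈ box 3 L ∧ 1 ≤ σ * v i} x y := by
  rintro ⟨x, hx, y, hy, hxF, hyF, hreach⟩
  apply hb
  refine ⟨x, hx, y, hy, ?_⟩
  have hFT : {v : Site 3 | v ∈ box 3 L ∧ 1 ≤ σ * v i} ⊆ (↑(box 3 L) : Set (Site 3)) :=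
    fun v hv => Finset.mem_coe.2 hv.1
  let φ : ((openGraph (ω \ ↑(S.filter fun e => ∀ v ∈ e, 1 ≤ σ * v i))).induce
        {v : Site 3 | v ∈ box 3 L ∧ 1 ≤ σ * v i}) →g
      ((openGraph (ω \ ↑S)).induce (↑(box 3 L) : Set (Site 3))) :=
    { toFun := fun v => ⟨v.1, hFT v.2⟩
      map_rel' := by
        intro a b hab
        simp only [SimpleGraph.induce_adj, openGraph_adj, Set.mem_sdiff, Finset.mem_coe,
          Finset.mem_filter] at hab ⊢
        refine ⟨⟨hab.1.1, fun hS => hab.1.2 ⟨hS, ?_⟩⟩, hab.2⟩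
        intro v hv
        rcases Sym2.mem_iff.1 hv with rfl | rfl
        · exact a.2.2
        · exact b.2.2 }
  exact ⟨hFT hxF, hFT hyF, hreach.map φ⟩

/-- The front parts of `S` for the two signs are disjoint, so their sizes add up to at most `#S`. -/
theorem card_filter_add_card_filter_le (S : Finset (Sym2 (Site 3))) (i : Fin 3) :
    (S.filter fun e => ∀ v ∈ e, 1 ≤ (1 : ℤ) * v i).card +
      (S.filter fun e => ∀ v ∈ e, 1 ≤ (-1 : ℤ) * v i).card ≤ S.card := by
  rw [← Finset.card_union_of_disjoint]
  · exact Finset.card_le_card (Finset.union_subset (Finset.filter_subset _ _) (Finset.filter_subset _ _))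
  · rw [Finset.disjoint_filter]
    intro e _ h1 h2
    induction e using Sym2.ind with
    | h u w =>
      have hu1 := h1 u (Sym2.mem_mk_left u w)
      have hu2 := h2 u (Sym2.mem_mk_left u w)
      linarith

/-! ### Reflection symmetry of the half-box budget events -/

section Transport

variable {V W : Type*}

/-- Relabelling back along `φ⁻¹` after removing the relabelled closed set gives `ω ∖ S`. -/
theorem relabel_symm_sdiff_map (φ : V ≃ W) (ω : BondConfig V) (S : Finset (Sym2 V)) :
    BondConfig.relabel (sym2Equiv φ.symm)
        (BondConfig.relabel (sym2Equiv φ) ω \ ↑(S.map (sym2Equiv φ).toEmbedding)) = ω \ ↑S := by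
  have key : ∀ z : Sym2 V, Sym2.map (⇑φ.symm) (Sym2.map (⇑φ) z) = z := fun z => by
    rw [Sym2.map_map, Equiv.symm_comp_self, Sym2.map_id]; rfl
  ext z
  simp only [BondConfig.mem_relabel_iff, sym2Equiv_symm, Equiv.symm_symm, Set.mem_sdiff, Finset.coe_map,
    Equiv.coe_toEmbedding, Finset.mem_coe, (sym2Equiv φ).injective.mem_set_image]
  constructor
  · rintro ⟨hz, hS⟩
    exact ⟨by simpa [key] using hz, hS⟩
  · rintro ⟨hz, hzS⟩
    exact ⟨by simpa [key] using hz, hzS⟩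

/-- **Transport of budget-blocked events.**  If closing at most `j` edges of `ω` leaves no open path from `A` to
`B` inside `F`, then closing at most `j` edges of the relabelled configuration `φ '' ω` leaves no open path from
`φ(A)` to `φ(B)` inside `φ(F)` (close the relabelled edges; pull a surviving path back along `φ⁻¹`,
`relabel_mem_openConnIn`). -/
theorem relabel_budgetBlocked (φ : V ≃ W) {F A B : Set V} {j : ℕ} {ω : BondConfig V}
    (h : ∃ S : Finset (Sym2 V), S.card ≤ j ∧ ¬ ∃ x ∈ A, ∃ y ∈ B, (ω \ ↑S) ∈ openConnIn F x y) :
    ∃ S' : Finset (Sym2 W), S'.card ≤ j ∧ ¬ ∃ x' ∈ φ '' A, ∃ y' ∈ φ '' B,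
      (BondConfig.relabel (sym2Equiv φ) ω \ ↑S') ∈ openConnIn (φ '' F) x' y' := by
  obtain ⟨S, hS, hb⟩ := h
  refine ⟨S.map (sym2Equiv φ).toEmbedding, by rwa [Finset.card_map], ?_⟩
  rintro ⟨_, ⟨x, hx, rfl⟩, _, ⟨y, hy, rfl⟩, hconn⟩
  apply hb
  refine ⟨x, hx, y, hy, ?_⟩
  have h' := relabel_mem_openConnIn φ.symm hconn
  rwa [Equiv.symm_image_image, Equiv.symm_apply_apply, Equiv.symm_apply_apply,
    relabel_symm_sdiff_map] at h'

/-- The budget-blocked event of the image data pulls back to the budget-blocked event. -/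
theorem preimage_relabel_budgetBlocked (φ : V ≃ W) (F A B : Set V) (j : ℕ) :
    BondConfig.relabel (sym2Equiv φ) ⁻¹'
        {ω' : BondConfig W | ∃ S' : Finset (Sym2 W), S'.card ≤ j ∧ ¬ ∃ x' ∈ φ '' A, ∃ y' ∈ φ '' B,
          (ω' \ ↑S') ∈ openConnIn (φ '' F) x' y'} =
      {ω : BondConfig V | ∃ S : Finset (Sym2 V), S.card ≤ j ∧ ¬ ∃ x ∈ A, ∃ y ∈ B,
        (ω \ ↑S) ∈ openConnIn F x y} := by
  ext ω
  simp only [Set.mem_preimage, Set.mem_setOf_eq]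
  constructor
  · intro h
    have h' := relabel_budgetBlocked φ.symm h
    rwa [Equiv.symm_image_image, Equiv.symm_image_image, Equiv.symm_image_image,
      relabel_symm_relabel] at h'
  · exact relabel_budgetBlocked φ

end Transport

/-- Budget-blocked events transported along an automorphism of `ℤ³` have the same critical probability. -/
theorem real_budgetBlocked_image (φ : zdGraph 3 ≃g zdGraph 3) (F A B : Set (Site 3)) (j : ℕ) :
    (bondPercolation (zdGraph 3) (criticalProbI 3)).real
        {ω : BondConfig (Site 3) | ∃ S : Finset (Sym2 (Site 3)), S.card ≤ j ∧ ¬ ∃ x ∈ φ '' A, ∃ y ∈ φ '' B,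
          (ω \ ↑S) ∈ openConnIn (φ '' F) x y} =
      (bondPercolation (zdGraph 3) (criticalProbI 3)).real
        {ω : BondConfig (Site 3) | ∃ S : Finset (Sym2 (Site 3)), S.card ≤ j ∧ ¬ ∃ x ∈ A, ∃ y ∈ B,
          (ω \ ↑S) ∈ openConnIn F x y} := by
  rw [← bondPercolation_real_preimage_relabel_iso φ (criticalProbI 3)]
  exact congrArg _ (preimage_relabel_budgetBlocked φ.toEquiv F A B j)

/-- The reflection `v_i ↦ -v_i` maps the open half-box `{v ∈ box 3 L | σ v_i ≥ 1}` onto `{v ∈ box 3 L | -σ v_i ≥ 1}`. -/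
theorem image_reflect_openHalfBox (i : Fin 3) (σ : ℤ) (L : ℕ) :
    (reflectIso i) '' {v : Site 3 | v ∈ box 3 L ∧ 1 ≤ σ * v i} =
      {v : Site 3 | v ∈ box 3 L ∧ 1 ≤ -σ * v i} := by
  ext v
  simp only [Set.mem_image, Set.mem_setOf_eq]
  constructor
  · rintro ⟨u, ⟨hu, hu1⟩, rfl⟩
    refine ⟨?_, ?_⟩
    · exact (signedPerm_mem_box_iff _ _).2 hu
    · rw [show ((reflectIso i : zdGraph 3 ≃g zdGraph 3) u) i = -u i from reflectIso_apply_same i u]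
      linarith
  · rintro ⟨hv, hv1⟩
    refine ⟨reflectIso i v, ⟨(signedPerm_mem_box_iff _ _).2 hv, ?_⟩, ?_⟩
    · rw [show ((reflectIso i : zdGraph 3 ≃g zdGraph 3) v) i = -v i from reflectIso_apply_same i v]
      linarith
    · funext j
      by_cases hj : j = i
      · subst hj; rw [reflectIso_apply_same, reflectIso_apply_same, neg_neg]
      · rw [reflectIso_apply_of_ne hj, reflectIso_apply_of_ne hj]

/-- The reflection `v_i ↦ -v_i` preserves `box 3 n` (as a set). -/
theorem image_reflect_box (i : Fin 3) (n : ℕ) :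
    (reflectIso i) '' (↑(box 3 n) : Set (Site 3)) = ↑(box 3 n) :=
  signedPerm_image_box _ _ n

/-- The reflection `v_i ↦ -v_i` preserves `∂ⁱⁿ box 3 L` (as a set). -/
theorem image_reflect_innerBoundary (i : Fin 3) (L : ℕ) :
    (reflectIso i) '' (↑(innerBoundary (zdGraph 3) (box 3 L)) : Set (Site 3)) =
      ↑(innerBoundary (zdGraph 3) (box 3 L)) :=
  StubSignedSymmetry.signedPerm_image_innerBoundary_box _ _ L

/-- **Reflection symmetry.**  The two open half-box budget-`j` blocking events (signs `σ` and `-σ`) have the same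
critical probability. -/
theorem real_halfBlocked_neg (j n L : ℕ) (i : Fin 3) (σ : ℤ) :
    (bondPercolation (zdGraph 3) (criticalProbI 3)).real
        {ω : BondConfig (Site 3) | ∃ S : Finset (Sym2 (Site 3)), S.card ≤ j ∧ ¬ ∃ x ∈ box 3 n,
          ∃ y ∈ innerBoundary (zdGraph 3) (box 3 L),
            (ω \ (↑S : Set (Sym2 (Site 3)))) ∈ openConnIn {v : Site 3 | v ∈ box 3 L ∧ 1 ≤ -σ * v i} x y} =
      (bondPercolation (zdGraph 3) (criticalProbI 3)).real
        {ω : BondConfig (Site 3) | ∃ S : Finset (Sym2 (Site 3)), S.card ≤ j ∧ ¬ ∃ x ∈ box 3 n,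
          ∃ y ∈ innerBoundary (zdGraph 3) (box 3 L),
            (ω \ (↑S : Set (Sym2 (Site 3)))) ∈ openConnIn {v : Site 3 | v ∈ box 3 L ∧ 1 ≤ σ * v i} x y} := by
  have h := real_budgetBlocked_image (reflectIso i) {v : Site 3 | v ∈ box 3 L ∧ 1 ≤ σ * v i}
    (↑(box 3 n)) (↑(innerBoundary (zdGraph 3) (box 3 L))) j
  rw [image_reflect_openHalfBox, image_reflect_box, image_reflect_innerBoundary] at h
  simpa only [Finset.mem_coe] using h

end HalfspaceHalving

open HalfspaceHalving in
/-- **Half-space halving of the budget** (registered auxiliary stub `stub_halfspaceHalving` of the crux skeleton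
`Cruxes/PinholeClosing/Lines/balanced_deletion.lean`; deterministic, every configuration).  For every axis `i`: if
the annulus `box 3 n → ∂ⁱⁿ box 3 L` of `ℤ³` is blocked inside `box 3 L` after closing at most `k + 1` edges, then for
`σ = 1` or `σ = -1` the open half-box `{v ∈ box 3 L | σ v_i ≥ 1}` carries no open path from `box 3 n` to `∂ⁱⁿ box 3 L`
after closing at most `(k + 1) / 2` edges.  Proof: split the blocking set by the side of its edges
(`card_filter_add_card_filter_le`) and use `front_blocked_of_cut` on the smaller side. -/
theorem stub_halfspaceHalving :
    ∀ (k n L : ℕ) (i : Fin 3) (ω : BondConfig (Site 3)),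
      ω ∈ {ω : BondConfig (Site 3) | ∃ S : Finset (Sym2 (Site 3)), S.card ≤ k + 1 ∧ ¬ ∃ x ∈ box 3 n,
        ∃ y ∈ innerBoundary (zdGraph 3) (box 3 L),
          (ω \ (↑S : Set (Sym2 (Site 3)))) ∈ openConnIn (↑(box 3 L) : Set (Site 3)) x y} →
      ∃ σ : ℤ, (σ = 1 ∨ σ = -1) ∧
        ω ∈ {ω : BondConfig (Site 3) | ∃ S : Finset (Sym2 (Site 3)), S.card ≤ (k + 1) / 2 ∧ ¬ ∃ x ∈ box 3 n,
          ∃ y ∈ innerBoundary (zdGraph 3) (box 3 L),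
            (ω \ (↑S : Set (Sym2 (Site 3)))) ∈ openConnIn {v : Site 3 | v ∈ box 3 L ∧ 1 ≤ σ * v i} x y} := by
  intro k n L i ω h
  obtain ⟨S, hS, hb⟩ := h
  have hcard := card_filter_add_card_filter_le S i
  by_cases h1 : (S.filter fun e => ∀ v ∈ e, 1 ≤ (1 : ℤ) * v i).card ≤ (k + 1) / 2
  · exact ⟨1, Or.inl rfl, _, h1, front_blocked_of_cut hb⟩
  · refine ⟨-1, Or.inr rfl, _, ?_, front_blocked_of_cut hb⟩
    omega

open HalfspaceHalving in
/-- **Union-bound form.**  For critical bond percolation on `ℤ³` and every axis `i`: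
`P(box 3 n → ∂ⁱⁿ box 3 L blocked after ≤ k+1 closures) ≤ Σ_{σ = ±1} P(the open half-box {σ v_i ≥ 1} is blocked
after ≤ (k+1)/2 closures)`.  Immediate from `stub_halfspaceHalving` and `measureReal_union_le`. -/
theorem halving_real_le (k n L : ℕ) (i : Fin 3) :
    (bondPercolation (zdGraph 3) (criticalProbI 3)).real
        {ω : BondConfig (Site 3) | ∃ S : Finset (Sym2 (Site 3)), S.card ≤ k + 1 ∧ ¬ ∃ x ∈ box 3 n,
          ∃ y ∈ innerBoundary (zdGraph 3) (box 3 L),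
            (ω \ (↑S : Set (Sym2 (Site 3)))) ∈ openConnIn (↑(box 3 L) : Set (Site 3)) x y} ≤
      (bondPercolation (zdGraph 3) (criticalProbI 3)).real
        {ω : BondConfig (Site 3) | ∃ S : Finset (Sym2 (Site 3)), S.card ≤ (k + 1) / 2 ∧ ¬ ∃ x ∈ box 3 n,
          ∃ y ∈ innerBoundary (zdGraph 3) (box 3 L),
            (ω \ (↑S : Set (Sym2 (Site 3)))) ∈ openConnIn {v : Site 3 | v ∈ box 3 L ∧ 1 ≤ (1 : ℤ) * v i} x y} +
      (bondPercolation (zdGraph 3) (criticalProbI 3)).real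
        {ω : BondConfig (Site 3) | ∃ S : Finset (Sym2 (Site 3)), S.card ≤ (k + 1) / 2 ∧ ¬ ∃ x ∈ box 3 n,
          ∃ y ∈ innerBoundary (zdGraph 3) (box 3 L),
            (ω \ (↑S : Set (Sym2 (Site 3)))) ∈ openConnIn {v : Site 3 | v ∈ box 3 L ∧ 1 ≤ (-1 : ℤ) * v i} x y} := by
  refine le_trans (measureReal_mono ?_) (measureReal_union_le _ _)
  intro ω hω
  obtain ⟨σ, hσ, hmem⟩ := stub_halfspaceHalving k n L i ω hω
  rcases hσ with rfl | rfl
  · exact Or.inl hmem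
  · exact Or.inr hmem

open HalfspaceHalving in
/-- **Symmetric form (the usable one).**  For critical bond percolation on `ℤ³`, every axis `i` and every `k, n, L`:
`P(box 3 n → ∂ⁱⁿ box 3 L blocked after ≤ k+1 closures) ≤ 2 · P(the open half-box {v_i ≥ 1} of box 3 L is blocked
after ≤ (k+1)/2 closures)` — budget-`(k+1)` tightness at one shape gives half-box tightness at the same shape with
HALF the budget and half the probability, uniformly in `n` (`halving_real_le` + `real_halfBlocked_neg`). -/
theorem halving_real_le_two_mul (k n L : ℕ) (i : Fin 3) :
    (bondPercolation (zdGraph 3) (criticalProbI 3)).real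
        {ω : BondConfig (Site 3) | ∃ S : Finset (Sym2 (Site 3)), S.card ≤ k + 1 ∧ ¬ ∃ x ∈ box 3 n,
          ∃ y ∈ innerBoundary (zdGraph 3) (box 3 L),
            (ω \ (↑S : Set (Sym2 (Site 3)))) ∈ openConnIn (↑(box 3 L) : Set (Site 3)) x y} ≤
      2 * (bondPercolation (zdGraph 3) (criticalProbI 3)).real
        {ω : BondConfig (Site 3) | ∃ S : Finset (Sym2 (Site 3)), S.card ≤ (k + 1) / 2 ∧ ¬ ∃ x ∈ box 3 n,
          ∃ y ∈ innerBoundary (zdGraph 3) (box 3 L),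
            (ω \ (↑S : Set (Sym2 (Site 3)))) ∈ openConnIn {v : Site 3 | v ∈ box 3 L ∧ 1 ≤ (1 : ℤ) * v i} x y} := by
  have h := halving_real_le k n L i
  have hneg := real_halfBlocked_neg ((k + 1) / 2) n L i 1
  rw [show (-1 : ℤ) = -(1 : ℤ) from rfl] at h
  rw [hneg] at h
  linarith

end Summit.CriticalPhenomena.PercolationContinuityZ3.Theorems

end
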